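import Literature.MathematicalPhysics.QuantumFieldTheory.Balaban1983to89.B9SectDWalk

/-!
# `Balaban1983to89.B9SectDWalkThrough` — the FAMILY-LEVEL form of *"a localization meeting Ωᶜ costs the factor
(3.154)"* ([Balaban1985BackgroundPropagators] Thm 3.14 p. 427) in the walk-expansion vocabulary of `B9SectDWalk`,
which is the abstract mechanism behind the σ-part `O(1)e^{−⅓δ₀M}` of [Balaban1988RG2Cluster] (2.16) p. 16
(*"Other localization domains X are chosen … and we assume that dist(X, Z₀) > ⅔M"*, p. 13): a SUB-FAMILY of walk
terms all of whose walk distances pass THROUGH a set `X` is majorized by the family's summability bound AT A REDUCED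
RATE times the uniform gain `e^{−ε·D_X(y,y′)}`, `D_X(y,y′) = inf_{z∈X}(d(y,z) + d(z,y′))` — so the part of a random
walk expansion that DEPENDS on data located in `X` (e.g. on the decoupling parameters `s(□)`, `□ ⊂ X`) is as small
as `X` is far, with no counting of walks

statement-level skeleton of published theorems with citation tags; proofs where landed; nothing here is a claim about
the Yang–Mills mass gap

Sources: [B9] T. Bałaban, *Propagators for lattice gauge theories in a background field*, Commun. Math. Phys. **99**
(1985) 389–434 [Balaban1985BackgroundPropagators], (3.93) p. 410, (3.154) p. 427; [II] T. Bałaban, *Renormalization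
group approach to lattice gauge field theories. II. Cluster expansions*, Commun. Math. Phys. **116** (1988) 1–22
[Balaban1988RG2Cluster], p. 13 (the σ-decoupled random walk expansions with `dist(X, Z₀) > ⅔M`), (2.16) p. 16 (the
σ-part `O(1)e^{−⅓δ₀M}`).  Held texts: `paper:balaban1988-cmp116-rg-ii-cluster` pp. 12–16 re-read this session by the
filing seat (materialised `p0012.txt`–`p0016.txt`; p. 13 l. 14–18 *"Other localization domains X are chosen as in
Sect. C [13], i.e. they are unions of small, connected families of M₁-cubes, and we assume that dist(X, Z₀) > ⅔M. For
this class of localization domains we construct the generalized random walk expansions."*).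

v1.1 DOCFIX (seat g1-p2 gen 3, 2026-08-23; decls byte-identical, docstrings only): the printed fraction on p. 13 is
«dist(X, Z₀) > ⅔M» (TWO thirds) — checked on the page render `b2b-balaban-ref1/pages/1988-cmp116-rg-II-cluster/…-p013-x2.png`
(the OCR text layer `p0013.txt` drops the fraction glyph; v1 wrote «⅓M», a transcription slip; confirmed independently by
lit-balaban r10 g32 and recorded by the B9 row owner r06 g19); (2.16)'s σ-part rate `e^{−⅓δ₀M}` is what survives of
`δ₀·⅔M` after p. 16's *"e^{−1/3δ₀M}e^{16κ₁} < 1"*.  No theorem is affected (`R` is a parameter throughout).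

WHAT IS REPRODUCED (cell `pub-balaban-gaps`, track G1, prover seat g1-p2 gen 2; binder (D4), NODE A.4 = (T3), item
(T3a) «σ-part bounds, asserted at (2.16), no printed derivation»; a NEW LEAF over `B9SectDWalk` (b2b-balaban-r1
lineage), nothing edited):
* `passDist_le_of_through` — a walk distance passing through `X` dominates `D_X` (`B9SectDWalk.passDist`).
* `term_through_le` — ONE walk term: `A·e^{−ρD(y,y′)} ≤ A·e^{−(ρ−ε)D(y,y′)}·e^{−εD_X(y,y′)}` when `D` passes through
  `X` (`0 ≤ ε`, `A ≥ 0`).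
* **`subfamily_through_sum_le`** — THE DECOUPLING GAIN: if the family `(A_ω e^{−(ρ−ε)D_ω})_ω` has uniformly bounded
  partial sums `≤ K̄` (`B9SectDWalk.MajSumLe`, at the REDUCED rate `ρ − ε`) and every member of the finite sub-family
  `S` has a walk distance through `X`, then `Σ_{ω∈S} A_ω e^{−ρD_ω(y,y′)} ≤ K̄(y,y′)·e^{−εD_X(y,y′)}`.
* `subfamily_through_hasMaj` — the same as an operator majorant: `Σ_{ω∈S} T_ω` has the block majorant
  `K̄·e^{−εD_X}` (`B11SectG.HasMaj`, `B9SectDWalk.hasMaj_finsetSum`).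
* `passDist_ge_of_far` — if `d(y,z) ≥ R` for all `z ∈ X` then `D_X(y,y′) ≥ R` (distances `≥ 0`): the gain is at
  least `e^{−εR}` UNIFORMLY in `y′` — print's `R = ⅔M`.
CONSEQUENCE FOR (D4)'s (T3a) (census language, not a theorem about Bałaban's kernels): IF the σ-dependent primitive
kernels of [II] §2 are given by generalized random walk expansions whose terms depend on `σ(□)` only for walks passing
through the σ-carrying region (p. 13: the cubes `Δ ∈ σ₀` lie outside the interior of `Z̃₀`, and the other localization
domains have `dist(X, Z₀) > ⅔M`) — an OBJECT-level statement of the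
same kind as L17a's expansions ([13] Thm 3.15-type, cell GAPS G-B9-10) — then the σ-DIFFERENCE of such a kernel on
`Z₀ × Z₀` is a sub-family sum of this kind (times `sup|σ − σ′|`-factors), and its (2.16)-shape bound with
`θ_σ = K̄-const·e^{−εR}`, `εR = ⅓δ₀M` (print p. 16: *"e^{−1/3δ₀M}e^{16κ₁} < 1"*), is `subfamily_through_sum_le` +
`passDist_ge_of_far`; i.e. (T3a) carries NO analytic input
beyond the walk expansion itself.
HONEST SCOPE.  Elementary real-analysis bookkeeping over `B9SectDWalk`; no walk expansion of any operator of Bałaban's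
is constructed; whether the σ-dependence of [II]'s kernels has the stated form is an OBJECT-level hypothesis (NODE O),
not proved here; nothing of cell GAPS G-B9-10 is resolved.  No `sorry`, no definition, no new named fact.  NOT B12
Thm 2, NOT `BetaPertH`, NOT continuum∕ℝ⁴, NOT Clay.
-/

namespace Literature.MathematicalPhysics.QuantumFieldTheory.Balaban1983to89.B9SectDWalkThrough

open Literature.MathematicalPhysics.QuantumFieldTheory.Balaban1983to89
open Finset B11SectG B9SectDWalk

variable {g : B6.Geometry}

/-! ## §1. One term: passage through `X` dominates `D_X`, and the gain at one term -/

/-- A walk distance passing THROUGH `X` dominates the elementary passage distance `D_X(y,y′) = inf_{z∈X}(d(y,z)+d(z,y′))`.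
[cite: Balaban1985BackgroundPropagators, (3.93) p.410] -/
theorem passDist_le_of_through {D : g.Site → g.Site → ℝ} {X : Finset g.Site} (hX : X.Nonempty)
    (h : Through g D (↑X : Set g.Site)) (y y' : g.Site) : passDist X hX y y' ≤ D y y' := by
  obtain ⟨z, hz, hle⟩ := h y y'
  exact (passDist_le hX (Finset.mem_coe.mp hz) y y').trans hle

/-- **The gain at ONE term**: if `D` passes through `X` then for `0 ≤ ε` and `A ≥ 0`,
`A·e^{−ρD(y,y′)} ≤ A·e^{−(ρ−ε)D(y,y′)}·e^{−εD_X(y,y′)}` — the rate surplus `ε` is converted into the uniform factor of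
the passage distance (*"a localization meeting Ωᶜ costs the factor (3.154)"*). [cite: Balaban1985BackgroundPropagators, (3.154) p.427] -/
theorem term_through_le {D : g.Site → g.Site → ℝ} {X : Finset g.Site} (hX : X.Nonempty)
    (h : Through g D (↑X : Set g.Site)) {A ρ ε : ℝ} (hA : 0 ≤ A) (hε : 0 ≤ ε) (y y' : g.Site) :
    A * Real.exp (-(ρ * D y y')) ≤
      A * Real.exp (-((ρ - ε) * D y y')) * Real.exp (-(ε * passDist X hX y y')) := by
  have hD := passDist_le_of_through hX h y y'
  rw [mul_assoc, ← Real.exp_add]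
  refine mul_le_mul_of_nonneg_left (Real.exp_le_exp.2 ?_) hA
  nlinarith [mul_le_mul_of_nonneg_left hD hε]

/-! ## §2. The sub-family through `X`: the decoupling gain, as sums and as operator majorants -/

/-- **THE DECOUPLING GAIN (family level).**  Let `(A_ω, D_ω)_ω` be walk terms' constants and walk distances, `A_ω ≥ 0`,
and suppose the family of majorants AT THE REDUCED RATE `ρ − ε` has uniformly bounded partial sums,
`Σ_{ω∈S′} A_ω e^{−(ρ−ε)D_ω} ≤ K̄` for every finite `S′` (`MajSumLe`).  If every member of the finite sub-family `S` has
its walk distance passing through `X`, then `Σ_{ω∈S} A_ω e^{−ρD_ω(y,y′)} ≤ K̄(y,y′)·e^{−εD_X(y,y′)}` — the part of the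
expansion localized through `X` is as small as `X` is far, WITHOUT counting walks (the summability is the family's).
This is the family-level form of (3.154), and the mechanism of [II]'s σ-part `O(1)e^{−⅓δ₀M}` in (2.16) for kernels
expanded with `dist(X, Z₀) > ⅔M`. [cite: Balaban1985BackgroundPropagators, (3.154) p.427; Balaban1988RG2Cluster, p.13 and (2.16) p.16] -/
theorem subfamily_through_sum_le {W : Type} {A : W → ℝ} {D : W → g.Site → g.Site → ℝ} {X : Finset g.Site}
    (hX : X.Nonempty) {ρ ε : ℝ} (hε : 0 ≤ ε) (hA : ∀ ω, 0 ≤ A ω) {Kbar : g.Site → g.Site → ℝ}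
    (hsum : MajSumLe (fun ω a b => A ω * Real.exp (-((ρ - ε) * D ω a b))) Kbar)
    (S : Finset W) (hS : ∀ ω ∈ S, Through g (D ω) (↑X : Set g.Site)) (y y' : g.Site) :
    ∑ ω ∈ S, A ω * Real.exp (-(ρ * D ω y y')) ≤ Kbar y y' * Real.exp (-(ε * passDist X hX y y')) := by
  calc ∑ ω ∈ S, A ω * Real.exp (-(ρ * D ω y y'))
      ≤ ∑ ω ∈ S, A ω * Real.exp (-((ρ - ε) * D ω y y')) * Real.exp (-(ε * passDist X hX y y')) :=
        Finset.sum_le_sum fun ω hω => term_through_le hX (hS ω hω) (hA ω) hε y y'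
    _ = (∑ ω ∈ S, A ω * Real.exp (-((ρ - ε) * D ω y y'))) * Real.exp (-(ε * passDist X hX y y')) := by
        rw [Finset.sum_mul]
    _ ≤ Kbar y y' * Real.exp (-(ε * passDist X hX y y')) :=
        mul_le_mul_of_nonneg_right (hsum S y y') (Real.exp_pos _).le

variable {F₁ F₂ : Type} [AddCommGroup F₁] [Module ℝ F₁] [AddCommGroup F₂] [Module ℝ F₂]

/-- **The decoupling gain as an OPERATOR majorant**: if each term `T_ω` has the block majorant `A_ω e^{−ρD_ω}`
(`B11SectG.HasMaj`), the reduced-rate family is summable with bound `K̄`, and the sub-family `S` passes through `X`,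
then `Σ_{ω∈S} T_ω` has the majorant `K̄·e^{−εD_X}`. [cite: Balaban1985BackgroundPropagators, (3.154) p.427; Balaban1988RG2Cluster, (2.16) p.16] -/
theorem subfamily_through_hasMaj {W : Type} {b₁ : BlockNorm g F₁} {b₂ : BlockNorm g F₂} {T : W → F₁ →ₗ[ℝ] F₂}
    {A : W → ℝ} {D : W → g.Site → g.Site → ℝ} {X : Finset g.Site} (hX : X.Nonempty) {ρ ε : ℝ} (hε : 0 ≤ ε)
    (hA : ∀ ω, 0 ≤ A ω) (hT : ∀ ω, HasMaj b₁ b₂ (T ω) (fun a b => A ω * Real.exp (-(ρ * D ω a b))))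
    {Kbar : g.Site → g.Site → ℝ} (hsum : MajSumLe (fun ω a b => A ω * Real.exp (-((ρ - ε) * D ω a b))) Kbar)
    (S : Finset W) (hS : ∀ ω ∈ S, Through g (D ω) (↑X : Set g.Site)) :
    HasMaj b₁ b₂ (∑ ω ∈ S, T ω) (fun a b => Kbar a b * Real.exp (-(ε * passDist X hX a b))) :=
  (hasMaj_finsetSum T _ hT S).mono fun a b => subfamily_through_sum_le hX hε hA hsum S hS a b

/-! ## §3. Far sets: the uniform gain `e^{−εR}` (print: `R = ⅔M`) -/

/-- If every point of `X` is at distance `≥ R` from `y` and the distance is non-negative, then `D_X(y,y′) ≥ R` for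
every `y′` — so the gain of §2 is at least `e^{−εR}` uniformly (p. 13: `dist(X, Z₀) > ⅔M` ⟹ the σ-part of (2.16) is
`O(1)e^{−⅓δ₀M}`, up to the rate bookkeeping). [cite: Balaban1988RG2Cluster, p.13 and (2.16) p.16] -/
theorem passDist_ge_of_far {X : Finset g.Site} (hX : X.Nonempty) (hd : ∀ a b : g.Site, 0 ≤ g.dist a b) {R : ℝ}
    {y : g.Site} (hfar : ∀ z ∈ X, R ≤ g.dist y z) (y' : g.Site) : R ≤ passDist X hX y y' :=
  Finset.le_inf' _ _ fun z hz => (hfar z hz).trans (le_add_of_nonneg_right (hd z y'))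

/-- **The far sub-family bound** (§2 + `passDist_ge_of_far`): with `X` at distance `≥ R` from `y`,
`Σ_{ω∈S} A_ω e^{−ρD_ω(y,y′)} ≤ K̄(y,y′)·e^{−εR}`. [cite: Balaban1988RG2Cluster, p.13 and (2.16) p.16] -/
theorem subfamily_far_sum_le {W : Type} {A : W → ℝ} {D : W → g.Site → g.Site → ℝ} {X : Finset g.Site}
    (hX : X.Nonempty) (hd : ∀ a b : g.Site, 0 ≤ g.dist a b) {ρ ε R : ℝ} (hε : 0 ≤ ε) (hA : ∀ ω, 0 ≤ A ω)
    {Kbar : g.Site → g.Site → ℝ} (hsum : MajSumLe (fun ω a b => A ω * Real.exp (-((ρ - ε) * D ω a b))) Kbar)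
    (S : Finset W) (hS : ∀ ω ∈ S, Through g (D ω) (↑X : Set g.Site)) {y : g.Site}
    (hfar : ∀ z ∈ X, R ≤ g.dist y z) (y' : g.Site) :
    ∑ ω ∈ S, A ω * Real.exp (-(ρ * D ω y y')) ≤ Kbar y y' * Real.exp (-(ε * R)) :=
  (subfamily_through_sum_le hX hε hA hsum S hS y y').trans
    (mul_le_mul_of_nonneg_left
      (Real.exp_le_exp.2 (neg_le_neg (mul_le_mul_of_nonneg_left (passDist_ge_of_far hX hd hfar y') hε)))
      (hsum.nonneg y y'))

end Literature.MathematicalPhysics.QuantumFieldTheory.Balaban1983to89.B9SectDWalkThrough
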